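import Summits.CriticalPhenomena.PercolationContinuityZ3.Theorems.Transplant.Slab111HubZone
import HarnessLib

/-!
# The HUB ROUTING of the `(111)`-films, IX: the cleared set of the UNCLIPPED shape — the radius-2 hexagon `W19` around the block centre

builds on p205010 (kernel theorem, internal audit signed; external expert review pending) — NOT used in this file.  Lane `prim-bschramm`, seat
`prim-bschramm-p2` (gen 36; class C1b; memo `HOME/bschramm/P2-LATTICES.md` §130); helper file (`--supports stmt-CriticalPhenomena-4575 --as helper`).
For the blocks `(z, t_R, t_D, s_R, s_D)` of «HexShadowVRouteData».`ShapedLinkage 3` with `t_R ≥ 2` and `s_R ≥ 2` (no clipping inside radius `2`) the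
gen-36 instance chooses the cleared vertex set **`W19 k z`**: all film vertices over `hexBall z 2` except the three corners of type `−2u` at level `0`
and the three corners of type `+2u` at level `k` (the only vertices of degree `≤ 1`; validated by the seat's exhaustive swap-pair search, memo §130).
* §1 relative columns `relC`, the 19 columns `hex2`, `W19`;
* §2 the two containments the node asks for (`W19_subset_blkR`, `mem_W19_of_hexBall_one`), `W19 = PR` for these blocks (`W19_subset_lift`);
* §3 what the dispatcher needs: columns of members are in `hex2` (`relC_mem_hex2`), BULK MEMBERSHIP (every vertex over `hex2` at a level in `[1, k−1]` is
  in `W19`: `vl_mem_W19`), and `sh x = vcol z (relC z x)`.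
[cite: DuminilCopinSidoraviciusTassion2016, §2.3 (proof of Fact 2: the ball B_R(z))]
-/

noncomputable section

namespace Summit.CriticalPhenomena.PercolationContinuityZ3.Theorems.Transplant

open Literature.Probability.Percolation Literature.Probability.LatticeModels SimpleGraph
open scoped Classical

namespace Slab111

variable {k : ℕ}

/-! ## §1 The set -/

/-- The column of `x` relative to `z`, as an integer pair. [folklore] -/
def relC (z : Site 2) (x : slab111 k) : ℤ × ℤ := ((sh x - z) 0, (sh x - z) 1)

/-- `sh x = vcol z (relC z x)`. [folklore] -/
theorem sh_eq_vcol_relC (z : Site 2) (x : slab111 k) : sh x = vcol z (relC z x) := by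
  ext i; fin_cases i <;> simp [relC, vcol]

/-- The 19 columns of the radius-2 hexagon (relative coordinates). [folklore] -/
def hex2 : List (ℤ × ℤ) :=
  [(0, 0), (1, 0), (0, -1), (-1, 1), (-1, 0), (0, 1), (1, -1), (2, 0), (0, -2), (-2, 2), (-2, 0), (0, 2), (2, -2), (1, 1), (2, -1), (1, -2),
    (-1, -1), (-2, 1), (-1, 2)]

/-- A corner of type `−2u`: `(−2,0), (0,2), (2,−2)` — at level `0` such a vertex has a single neighbour in the hexagon. [folklore] -/
def IsNegCorner (p : ℤ × ℤ) : Prop := p = (-2, 0) ∨ p = (0, 2) ∨ p = (2, -2)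

/-- A corner of type `+2u`: `(2,0), (0,−2), (−2,2)` — at level `k` such a vertex has a single neighbour in the hexagon. [folklore] -/
def IsPosCorner (p : ℤ × ℤ) : Prop := p = (2, 0) ∨ p = (0, -2) ∨ p = (-2, 2)

/-- **The cleared set of the unclipped shape**: the lift of `hexBall z 2` minus the `−2u` corners at level `0` and the `+2u` corners at level `k`.
[cite: DuminilCopinSidoraviciusTassion2016, §2.3 (proof of Fact 2: the ball B_R(z))] -/
def W19 (k : ℕ) (z : Site 2) : Set (slab111 k) :=
  {x | tnZ (relC z x) ≤ 2 ∧ ¬ (lev (x : Site 3) = 0 ∧ IsNegCorner (relC z x)) ∧ ¬ (lev (x : Site 3) = k ∧ IsPosCorner (relC z x))}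

/-- `tnZ (relC z x) = triNorm (sh x − z)`. [folklore] -/
theorem tnZ_relC (z : Site 2) (x : slab111 k) : tnZ (relC z x) = triNorm (sh x - z) := by
  simp [tnZ, relC, triNorm]

/-! ## §2 The containments -/

/-- **`W19` lies over the cleared block** for every `t_D, s_D ≥ 2`. [folklore] -/
theorem W19_subset_blkR (z : Site 2) {tD sD : ℕ} (ht : 2 ≤ tD) (hs : 2 ≤ sD) : ∀ x ∈ W19 k z, (hexShadow k).sh x ∈ blkR 3 z tD sD := by
  intro x hx
  have h2 := hx.1
  rw [tnZ_relC] at h2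
  have h2' : triNorm (sh x - z) ≤ 2 := h2
  simp only [hexShadow_sh, mem_blkR, mem_hexBall]
  have habs := h2'
  simp only [triNorm, Pi.sub_apply, max_le_iff, abs_le] at habs
  refine ⟨by omega, by omega, by omega⟩

/-- **`W19` contains every vertex over `hexBall z 1`** (no corner is that close to the centre). [folklore] -/
theorem mem_W19_of_hexBall_one (z : Site 2) (x : slab111 k) (h1 : (hexShadow k).sh x ∈ hexBall z 1) : x ∈ W19 k z := by
  simp only [hexShadow_sh, mem_hexBall] at h1
  have h1' : triNorm (sh x - z) ≤ 1 := by exact_mod_cast h1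
  have habs := h1'
  simp only [triNorm, Pi.sub_apply, max_le_iff, abs_le] at habs
  refine ⟨by rw [tnZ_relC]; omega, ?_, ?_⟩
  · rintro ⟨-, hc⟩
    rcases hc with hc | hc | hc <;> simp only [relC, Prod.mk.injEq, Pi.sub_apply] at hc <;> omega
  · rintro ⟨-, hc⟩
    rcases hc with hc | hc | hc <;> simp only [relC, Prod.mk.injEq, Pi.sub_apply] at hc <;> omega

/-- For `t_R, s_R ≥ 2` every vertex of `W19` lies over the rerouting block, so `W19 ∩ lift(blk_R) = W19`. [folklore] -/
theorem W19_subset_lift (z : Site 2) {tR sR : ℕ} (ht : 2 ≤ tR) (hs : 2 ≤ sR) : W19 k z ⊆ (hexShadow k).lift (blkR 3 z tR sR) := fun x hx => by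
  rw [HexShadow.mem_lift]; exact W19_subset_blkR z ht hs x hx

/-! ## §3 Columns of members and bulk membership -/

/-- A pair of `tnZ ≤ 2` is one of the 19 columns. [folklore] -/
theorem mem_hex2_of_tnZ {p : ℤ × ℤ} (h : tnZ p ≤ 2) : p ∈ hex2 := by
  obtain ⟨a, b⟩ := p
  simp only [tnZ, max_le_iff, abs_le] at h
  obtain ⟨⟨ha1, ha2⟩, ⟨hb1, hb2⟩, hab1, hab2⟩ := h
  simp only [hex2, List.mem_cons, Prod.mk.injEq, List.not_mem_nil, or_false]
  interval_cases a <;> interval_cases b <;> omega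

/-- **The column of a member of `W19` is one of the 19.** [folklore] -/
theorem relC_mem_hex2 {z : Site 2} {x : slab111 k} (hx : x ∈ W19 k z) : relC z x ∈ hex2 := mem_hex2_of_tnZ hx.1

/-- The columns of `hex2` have `tnZ ≤ 2`. [folklore] -/
theorem tnZ_le_of_mem_hex2 : ∀ p ∈ hex2, tnZ p ≤ 2 := by decide

/-- Admissibility of a vertex over a relative column from the class condition. [folklore] -/
theorem adm_vcol {z : Site 2} {c0 : ℤ} (hz : (3 : ℤ) ∣ z 0 + 2 * z 1 - c0) {q : ℤ × ℤ} {L : ℤ} (h0 : 0 ≤ L) (hk : L ≤ k)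
    (hq : (3 : ℤ) ∣ L - c0 - (q.1 + 2 * q.2)) : Adm k (vcol z q) L :=
  ⟨by simpa [lvl] using dvd_base hz hq, h0, hk⟩

/-- The relative column of `vl k (vcol z q) L` is `q`. [folklore] -/
theorem relC_vl {z : Site 2} {q : ℤ × ℤ} {L : ℤ} (h : Adm k (vcol z q) L) : relC z (vl k (vcol z q) L) = q := by
  have hs : sh (vl k (vcol z q) L) = vcol z q := sh_vl h
  unfold relC; rw [hs]; ext <;> simp

/-- **BULK MEMBERSHIP**: every film vertex over a column of the hexagon at a level in `[1, k−1]` lies in `W19`. [folklore] -/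
theorem vl_mem_W19 {z : Site 2} {c0 : ℤ} (hz : (3 : ℤ) ∣ z 0 + 2 * z 1 - c0) :
    ∀ q ∈ hex2, ∀ L : ℤ, 1 ≤ L → L ≤ (k : ℤ) - 1 → (3 : ℤ) ∣ L - c0 - (q.1 + 2 * q.2) → vl k (vcol z q) L ∈ W19 k z := by
  intro q hq L h1 hk hd
  have hadm := adm_vcol (k := k) hz (by omega) (by omega) hd
  refine ⟨?_, ?_, ?_⟩
  · rw [relC_vl hadm]; exact tnZ_le_of_mem_hex2 q hq
  · rintro ⟨h0, -⟩; rw [lev_vl hadm] at h0; omega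
  · rintro ⟨hK, -⟩; rw [lev_vl hadm] at hK; omega

/-- **The facts about a member of `W19` the dispatcher uses**: its relative column is in `hex2`, `sh x = vcol z (relC z x)`, and its level is in
`[0, k]`. [folklore] -/
theorem member_facts {z : Site 2} {x : slab111 k} (hx : x ∈ W19 k z) :
    relC z x ∈ hex2 ∧ sh x = vcol z (relC z x) ∧ 0 ≤ lev (x : Site 3) ∧ lev (x : Site 3) ≤ k :=
  ⟨relC_mem_hex2 hx, sh_eq_vcol_relC z x, (mem_slab111_iff_lev.1 x.2).1, (mem_slab111_iff_lev.1 x.2).2⟩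

/-- The class datum of the centre: `c0 := z₀ + 2z₁` itself works (`3 ∣ z₀ + 2z₁ − c0`). [folklore] -/
theorem dvd_cls_self (z : Site 2) : (3 : ℤ) ∣ z 0 + 2 * z 1 - (z 0 + 2 * z 1) := by simp

end Slab111

end Summit.CriticalPhenomena.PercolationContinuityZ3.Theorems.Transplant

end
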